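import Mathlib
import Summits.Ventures.PercRepro2.Defs
import Summits.Ventures.PercRepro2.Independence
import Summits.Ventures.PercRepro2.Harris
import Summits.Ventures.PercRepro2.Graph
import Summits.Ventures.PercRepro2.Exploration
import Summits.Ventures.PercRepro2.Events
import Summits.Ventures.PercRepro2.FourFunctions
import Summits.Ventures.PercRepro2.Induced
import Summits.Ventures.PercRepro2.Frontier
import Summits.Ventures.PercRepro2.ObsIndependence
import Summits.Ventures.PercRepro2.BHK
import Summits.Ventures.PercRepro2.BHKEvents
import Summits.Ventures.PercRepro2.OrderPreservation

/-!
# Two-root negative correlation across clusters (blind cell PercRepro2, typer-1)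

The lead's "2-root NC" (`proofs/LEAD-PROOFSHAPES.md` §8.9 ADDENDUM 9 (3)(a)):

  `P(o ↔ a₁, b ↔ a₂, a₁ ↮ a₂) · P(a₁ ↮ a₂) ≤ P(o ↔ a₁, a₁ ↮ a₂) · P(b ↔ a₂, a₁ ↮ a₂)`

— conditionally on `a₁ ↮ a₂`, the events "`o` joins the cluster of `a₁`" and "`b` joins the
cluster of `a₂`" are negatively correlated.  It is the event form of p1's cross-cluster BHK
inequality `bhk_cross_cluster` (BHKEvents.lean; van den Berg–Häggström–Kahn Thm 1.4) for the
up-sets `{W | b ∈ W}` at the root `a₂` and `{W | o ∈ W}` at the root `a₁`; recorded here as a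
named theorem with the general cluster-property form `nc_two_root_cluster`.
-/

namespace Summit.Ventures.PercRepro2

section CrossRoot

variable {V : Type*} {E : Type*} [Fintype E] [DecidableEq E] [Fintype V] [DecidableEq V]
  {R : Type*} [CommRing R] [LinearOrder R] [IsStrictOrderedRing R]

/-- **Two-root negative correlation, cluster-property form**: for up-sets `𝓤` (at the root `a₁`)
and `𝓥` (at the root `a₂`),
`P(C(a₁) ∈ 𝓤, C(a₂) ∈ 𝓥, a₁ ↮ a₂) · P(a₁ ↮ a₂) ≤ P(C(a₁) ∈ 𝓤, a₁ ↮ a₂) · P(C(a₂) ∈ 𝓥, a₁ ↮ a₂)`. -/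
theorem nc_two_root_cluster (p : E → R) (hp : IsProbVec p) (ends : E → Sym2 V) (a₁ a₂ : V)
    {𝓤 𝓥 : Set (Set V)} (h𝓤 : IsUpperSet 𝓤) (h𝓥 : IsUpperSet 𝓥) :
    prob p (clusterInEvent ends a₁ 𝓤 ∩ clusterInEvent ends a₂ 𝓥 ∩ (connEvent ends a₁ a₂)ᶜ) *
        prob p (connEvent ends a₁ a₂)ᶜ ≤
      prob p (clusterInEvent ends a₁ 𝓤 ∩ (connEvent ends a₁ a₂)ᶜ) *
        prob p (clusterInEvent ends a₂ 𝓥 ∩ (connEvent ends a₁ a₂)ᶜ) :=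
  bhk_cross_cluster p hp ends a₁ a₂ h𝓤 h𝓥

/-- **2-root NC** (LEAD-PROOFSHAPES §8.9 ADDENDUM 9 (3)(a)):
`P(o ↔ a₁, b ↔ a₂, a₁ ↮ a₂) · P(a₁ ↮ a₂) ≤ P(o ↔ a₁, a₁ ↮ a₂) · P(b ↔ a₂, a₁ ↮ a₂)`. -/
theorem nc_two_root (p : E → R) (hp : IsProbVec p) (ends : E → Sym2 V) (o a₁ a₂ b : V) :
    prob p (connEvent ends a₁ o ∩ connEvent ends a₂ b ∩ (connEvent ends a₁ a₂)ᶜ) *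
        prob p (connEvent ends a₁ a₂)ᶜ ≤
      prob p (connEvent ends a₁ o ∩ (connEvent ends a₁ a₂)ᶜ) *
        prob p (connEvent ends a₂ b ∩ (connEvent ends a₁ a₂)ᶜ) := by
  rw [connEvent_eq_clusterInEvent ends a₁ o, connEvent_eq_clusterInEvent ends a₂ b]
  exact nc_two_root_cluster p hp ends a₁ a₂ (isUpperSet_mem_setOf o) (isUpperSet_mem_setOf b)

/-- **2-root NC, written from the side of `o` and `b`**:
`P(o ↔ a₁, b ↔ a₂, a₁ ↮ a₂) · P(a₁ ↮ a₂) ≤ P(o ↔ a₁, a₁ ↮ a₂) · P(b ↔ a₂, a₁ ↮ a₂)`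
with the connection events in the order `o ↔ a₁`, `b ↔ a₂`. -/
theorem nc_two_root' (p : E → R) (hp : IsProbVec p) (ends : E → Sym2 V) (o a₁ a₂ b : V) :
    prob p (connEvent ends o a₁ ∩ connEvent ends b a₂ ∩ (connEvent ends a₁ a₂)ᶜ) *
        prob p (connEvent ends a₁ a₂)ᶜ ≤
      prob p (connEvent ends o a₁ ∩ (connEvent ends a₁ a₂)ᶜ) *
        prob p (connEvent ends b a₂ ∩ (connEvent ends a₁ a₂)ᶜ) := by
  rw [connEvent_comm ends o a₁, connEvent_comm ends b a₂]
  exact nc_two_root p hp ends o a₁ a₂ b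

end CrossRoot

end Summit.Ventures.PercRepro2
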